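import Literature.NumberTheory.Transcendental.CurvePeriodsPathCalculusProofs
import Literature.NumberTheory.Transcendental.CurvePeriodsChartsProofs
import Mathlib.Analysis.Normed.Module.Convex
import HarnessLib

/-!
# Periods of curve type: paths inside one holomorphic chart

Companion of `Literature/NumberTheory/Transcendental/CurvePeriods.lean` (Huber–Wüstholz 2022,
Thm. 13.3 (2), rendered on explicit period symbols `(Z, ω, γ)` with the elementary relations
(R1)–(R5); the general statement is the named fact `HuberWustholzCurvePeriods`). By
`CurvePeriodsChartsProofs.lean` every point of an embedded smooth affine curve `Z` over `ℚ̄` has a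
neighbourhood `Ω` in which `Z(ℂ)` is the image of a disc `B ⊂ ℂ` under a holomorphic map `ψ`
(a chart). This file records what the boundary relation (R5) gives INSIDE such a chart — the
local, genus-independent part of the statement that the symbol `(Z, ω, γ)` only depends on the
relative homology class of `γ` (book §3.3.1):

* `span_single_sub_single_of_lift` — two `C¹` paths `γ₀ = ψ ∘ w₀`, `γ₁ = ψ ∘ w₁` lifting to a
  CONVEX open set of parameters on which `ψ` is holomorphic with values in `Z`, with the same
  (algebraic) end points, have the same symbol modulo relations (the straight-line homotopy
  `ψ((1 − s)w₀ + s w₁)`, `span_single_sub_single_of_homotopy`);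
* `rel_chartTriangle` — the three chart-straight paths `ψ([b₀, b₁])`, `ψ([b₁, b₂])`, `ψ([b₀, b₂])`
  between algebraic points form ONE elementary relation (R5) (the triangle
  `ψ(b₀ + x(b₁ − b₀) + y(b₂ − b₀))`);
* `span_single_sub_single_of_subset_chart`, `span_single_of_loop_subset_chart`,
  `span_quadrilateral_of_subset_chart`, `span_cell_of_subset_chart` — consequently, in a chart
  neighbourhood `Ω` of `exists_localChart`: paths in `Ω` with the same algebraic end points are
  equivalent, loops in `Ω` at an algebraic point are relations, and four paths in `Ω` forming a
  quadrilateral with algebraic corners sum to a relation (`γ₀₁ + γ₁₂ + γ₂₃ − γ₀₃ ∼ 0`, or in grid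
  orientation `bottom + right − top − left ∼ 0`) — the cell relation used when a homotopy is cut
  into small squares.

## References

* A. Huber, G. Wüstholz, *Transcendence and Linear Relations of 1-Periods*, Cambridge Tracts in
  Mathematics 227, CUP 2022 [HuberWustholz2022]: §3.3.1 (pp. 42–44 of the held text), Thm. 13.3 (2)
  (p. 121).
-/

noncomputable section

open scoped BigOperators Topology
open MvPolynomial Set Filter

namespace Literature.NumberTheory.Transcendental

namespace CurvePeriods

set_option quotPrecheck false in
/-- Membership in the `ℚ̄`-span of the elementary relations, in the format of the conclusion of
`HuberWustholzCurvePeriods`. -/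
local notation "InSpan" c:max => ∃ (k : ℕ) (ρ : Fin k → (PeriodSymbol →₀ ℂ)) (a : Fin k → ℂ),
  (∀ l, IsElementaryRelation (ρ l)) ∧ (∀ l, IsAlgebraic ℚ (a l)) ∧ c = ∑ l, a l • ρ l

variable {Z : CurveData}

/-! ### Segments of parameters -/

/-- The point `(1 − t) b₀ + t b₁` of the segment `[b₀, b₁] ⊂ ℂ`, real parameter. [folklore] -/
def segPoint (b₀ b₁ : ℂ) (t : ℝ) : ℂ := ((1 - t : ℝ) : ℂ) * b₀ + (t : ℂ) * b₁

/-- `segPoint` is smooth in `t`. [folklore] -/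
theorem contDiff_segPoint (b₀ b₁ : ℂ) {n : WithTop ℕ∞} : ContDiff ℝ n (segPoint b₀ b₁) :=
  ((Complex.ofRealCLM.contDiff.comp (contDiff_const.sub contDiff_id)).mul contDiff_const).add
    ((Complex.ofRealCLM.contDiff.comp contDiff_id).mul contDiff_const)

/-- `segPoint b₀ b₁ 0 = b₀`. [folklore] -/
@[simp] theorem segPoint_zero (b₀ b₁ : ℂ) : segPoint b₀ b₁ 0 = b₀ := by simp [segPoint]

/-- `segPoint b₀ b₁ 1 = b₁`. [folklore] -/
@[simp] theorem segPoint_one (b₀ b₁ : ℂ) : segPoint b₀ b₁ 1 = b₁ := by simp [segPoint]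

/-- The segment stays in any convex set containing its end points. [folklore] -/
theorem segPoint_mem {T : Set ℂ} (hT : Convex ℝ T) {b₀ b₁ : ℂ} (h₀ : b₀ ∈ T) (h₁ : b₁ ∈ T)
    {t : ℝ} (ht : t ∈ Icc (0 : ℝ) 1) : segPoint b₀ b₁ t ∈ T := by
  have h := hT h₀ h₁ (sub_nonneg.mpr ht.2) ht.1 (sub_add_cancel 1 t)
  simpa only [segPoint, Complex.real_smul] using h

/-- A convex combination `(1 − s) u + s v` of two points of a convex set, `s ∈ [0,1]`. [folklore] -/
theorem convexComb_mem {T : Set ℂ} (hT : Convex ℝ T) {u v : ℂ} (hu : u ∈ T) (hv : v ∈ T)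
    {s : ℝ} (hs : s ∈ Icc (0 : ℝ) 1) : ((1 - s : ℝ) : ℂ) * u + (s : ℂ) * v ∈ T :=
  segPoint_mem hT hu hv hs

/-! ### Paths lifting to a convex set of parameters -/

section Lift

variable {T : Set ℂ} (hT : Convex ℝ T) (hTo : IsOpen T) {ψ : ℂ → (Fin Z.n → ℂ)}
  (hψ : AnalyticOnNhd ℂ ψ T) (hψZ : MapsTo ψ T Z.points)

include hψ in
/-- A holomorphic map is real-`C¹`. [folklore] -/
theorem contDiffOn_real_of_analyticOnNhd : ContDiffOn ℝ 1 ψ T := by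
  have h : ContDiffOn ℂ 1 ψ T := fun x hx => (hψ x hx).contDiffAt.contDiffWithinAt
  exact h.restrict_scalars ℝ

include hT hψ hψZ in
/-- **Two paths with a common convex lift have the same symbol.** If `γ_r(t) = ψ(w_r(t))` on
`[0,1]` (`r = 0, 1`) with `w_r` real-`C¹` on `[0,1]`, values in the convex open set `T` on which
`ψ` is holomorphic with values in `Z(ℂ)`, and `w₀, w₁` agree at `t = 0` and `t = 1`, then
`(Z, ω, γ₀) − (Z, ω, γ₁)` lies in the span of the elementary relations (the `C¹` homotopy
`ψ((1 − s) w₀(t) + s w₁(t))` with fixed end points). [cite: HuberWustholz2022, §3.3.1 (pp. 42–44)] -/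
theorem span_single_sub_single_of_lift (hZ : Z.IsSmoothAffineCurve)
    (ω : Fin Z.n → MvPolynomial (Fin Z.n) ℂ) (h : ∀ i, HasAlgCoeffs (ω i)) (γ₀ γ₁ : CurvePath Z)
    (w₀ w₁ : ℝ → ℂ) (hw₀ : ContDiffOn ℝ 1 w₀ (Icc 0 1)) (hw₁ : ContDiffOn ℝ 1 w₁ (Icc 0 1))
    (hw₀T : MapsTo w₀ (Icc 0 1) T) (hw₁T : MapsTo w₁ (Icc 0 1) T)
    (hγ₀ : ∀ t ∈ Icc (0 : ℝ) 1, γ₀.toFun t = ψ (w₀ t))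
    (hγ₁ : ∀ t ∈ Icc (0 : ℝ) 1, γ₁.toFun t = ψ (w₁ t))
    (h0 : w₀ 0 = w₁ 0) (h1 : w₀ 1 = w₁ 1) :
    InSpan (Finsupp.single (⟨Z, hZ, ω, h, γ₀⟩ : PeriodSymbol) (1 : ℂ) -
        Finsupp.single ⟨Z, hZ, ω, h, γ₁⟩ 1) := by
  -- the straight-line homotopy of the lifts
  let L : ℝ × ℝ → ℂ := fun q => ((1 - q.1 : ℝ) : ℂ) * w₀ q.2 + (q.1 : ℂ) * w₁ q.2
  have hLC : ContDiffOn ℝ 1 L (Icc (0 : ℝ) 1 ×ˢ Icc (0 : ℝ) 1) := by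
    have h₀ : ContDiffOn ℝ 1 (fun q : ℝ × ℝ => w₀ q.2) (Icc (0 : ℝ) 1 ×ˢ Icc (0 : ℝ) 1) :=
      hw₀.comp contDiff_snd.contDiffOn fun q hq => hq.2
    have h₁ : ContDiffOn ℝ 1 (fun q : ℝ × ℝ => w₁ q.2) (Icc (0 : ℝ) 1 ×ˢ Icc (0 : ℝ) 1) :=
      hw₁.comp contDiff_snd.contDiffOn fun q hq => hq.2
    have hs : ContDiff ℝ 1 fun q : ℝ × ℝ => ((1 - q.1 : ℝ) : ℂ) :=
      Complex.ofRealCLM.contDiff.comp (contDiff_const.sub contDiff_fst)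
    have hs' : ContDiff ℝ 1 fun q : ℝ × ℝ => ((q.1 : ℝ) : ℂ) :=
      Complex.ofRealCLM.contDiff.comp contDiff_fst
    exact (hs.contDiffOn.mul h₀).add (hs'.contDiffOn.mul h₁)
  have hLT : MapsTo L (Icc (0 : ℝ) 1 ×ˢ Icc (0 : ℝ) 1) T := fun q hq =>
    convexComb_mem hT (hw₀T hq.2) (hw₁T hq.2) hq.1
  refine span_single_sub_single_of_homotopy hZ ω h (fun q => ψ (L q))
    ((contDiffOn_real_of_analyticOnNhd hψ).comp hLC hLT) (fun q hq => hψZ (hLT hq))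
    (fun s _ => ?_) (fun s _ => ?_) γ₀ γ₁ (fun t ht => ?_) (fun t ht => ?_)
  · show ψ (((1 - s : ℝ) : ℂ) * w₀ 0 + (s : ℂ) * w₁ 0) =
      ψ (((1 - 0 : ℝ) : ℂ) * w₀ 0 + ((0 : ℝ) : ℂ) * w₁ 0)
    rw [← h0]; congr 1; push_cast; ring
  · show ψ (((1 - s : ℝ) : ℂ) * w₀ 1 + (s : ℂ) * w₁ 1) =
      ψ (((1 - 0 : ℝ) : ℂ) * w₀ 1 + ((0 : ℝ) : ℂ) * w₁ 1)
    rw [← h1]; congr 1; push_cast; ring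
  · rw [hγ₀ t ht]
    show ψ (w₀ t) = ψ (((1 - 0 : ℝ) : ℂ) * w₀ t + ((0 : ℝ) : ℂ) * w₁ t)
    congr 1; push_cast; ring
  · rw [hγ₁ t ht]
    show ψ (w₁ t) = ψ (((1 - 1 : ℝ) : ℂ) * w₀ t + ((1 : ℝ) : ℂ) * w₁ t)
    congr 1; push_cast; ring

/-- **The chart-straight path** `t ↦ ψ((1 − t) b₀ + t b₁)` between two points of a chart whose
images are algebraic points. [folklore] -/
def chartSegment (hT : Convex ℝ T) (hψ : AnalyticOnNhd ℂ ψ T) (hψZ : MapsTo ψ T Z.points)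
    (b₀ b₁ : ℂ) (hb₀ : b₀ ∈ T) (hb₁ : b₁ ∈ T) (ha₀ : ∀ i, IsAlgebraic ℚ (ψ b₀ i))
    (ha₁ : ∀ i, IsAlgebraic ℚ (ψ b₁ i)) : CurvePath Z where
  toFun := fun t => ψ (segPoint b₀ b₁ t)
  contDiffOn := (contDiffOn_real_of_analyticOnNhd hψ).comp (contDiff_segPoint b₀ b₁).contDiffOn
    fun _ ht => segPoint_mem hT hb₀ hb₁ ht
  mem_points := fun _ ht => hψZ (segPoint_mem hT hb₀ hb₁ ht)
  algebraic_zero := fun i => by rw [segPoint_zero]; exact ha₀ i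
  algebraic_one := fun i => by rw [segPoint_one]; exact ha₁ i

include hT hψ hψZ in
/-- **Three chart-straight paths form an elementary relation**: for `b₀, b₁, b₂ ∈ T` and paths
`σ₀₁, σ₁₂, σ₀₂` agreeing on `[0,1]` with `ψ([b₀,b₁])`, `ψ([b₁,b₂])`, `ψ([b₀,b₂])`,
`(Z, ω, σ₀₁) + (Z, ω, σ₁₂) − (Z, ω, σ₀₂)` is the boundary (R5) of the `C¹` triangle
`τ(x, y) = ψ(b₀ + x(b₁ − b₀) + y(b₂ − b₀))`. [cite: HuberWustholz2022, §3.3.1 (pp. 42–44)] -/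
theorem rel_chartTriangle (hZ : Z.IsSmoothAffineCurve)
    (ω : Fin Z.n → MvPolynomial (Fin Z.n) ℂ) (h : ∀ i, HasAlgCoeffs (ω i)) {b₀ b₁ b₂ : ℂ}
    (hb₀ : b₀ ∈ T) (hb₁ : b₁ ∈ T) (hb₂ : b₂ ∈ T) (σ₀₁ σ₁₂ σ₀₂ : CurvePath Z)
    (h₀₁ : ∀ t ∈ Icc (0 : ℝ) 1, σ₀₁.toFun t = ψ (segPoint b₀ b₁ t))
    (h₁₂ : ∀ t ∈ Icc (0 : ℝ) 1, σ₁₂.toFun t = ψ (segPoint b₁ b₂ t))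
    (h₀₂ : ∀ t ∈ Icc (0 : ℝ) 1, σ₀₂.toFun t = ψ (segPoint b₀ b₂ t)) :
    IsElementaryRelation
      (Finsupp.single (⟨Z, hZ, ω, h, σ₀₁⟩ : PeriodSymbol) (1 : ℂ) +
          Finsupp.single ⟨Z, hZ, ω, h, σ₁₂⟩ 1 - Finsupp.single ⟨Z, hZ, ω, h, σ₀₂⟩ 1) := by
  -- the affine triangle of parameters
  let A : ℝ × ℝ → ℂ := fun q => b₀ + (q.1 : ℂ) * (b₁ - b₀) + (q.2 : ℂ) * (b₂ - b₀)
  have hAC : ContDiff ℝ 1 A :=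
    (contDiff_const.add ((Complex.ofRealCLM.contDiff.comp contDiff_fst).mul contDiff_const)).add
      ((Complex.ofRealCLM.contDiff.comp contDiff_snd).mul contDiff_const)
  have hAT : MapsTo A stdTriangle T := fun q hq => by
    -- `A q = (1 − x − y) b₀ + x b₁ + y b₂`, a convex combination
    have hw₀ : ∀ i ∈ (Finset.univ : Finset (Fin 3)), 0 ≤ ![1 - q.1 - q.2, q.1, q.2] i := by
      intro i _
      fin_cases i
      · show 0 ≤ 1 - q.1 - q.2
        linarith [hq.2.2]
      · exact hq.1
      · exact hq.2.1
    have hw₁ : ∑ i ∈ (Finset.univ : Finset (Fin 3)), ![1 - q.1 - q.2, q.1, q.2] i = 1 := by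
      rw [Fin.sum_univ_three]
      show (1 - q.1 - q.2) + q.1 + q.2 = 1
      ring
    have hzT : ∀ i ∈ (Finset.univ : Finset (Fin 3)), ![b₀, b₁, b₂] i ∈ T := by
      intro i _
      fin_cases i
      · exact hb₀
      · exact hb₁
      · exact hb₂
    have hm := hT.sum_mem hw₀ hw₁ hzT
    rw [Fin.sum_univ_three] at hm
    have he : A q = (1 - q.1 - q.2) • b₀ + q.1 • b₁ + q.2 • b₂ := by
      simp only [A, Complex.real_smul]
      push_cast
      ring
    rw [he]
    exact hm
  refine IsElementaryRelation.boundary Z hZ ω h (fun q => ψ (A q))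
    ((contDiffOn_real_of_analyticOnNhd hψ).comp hAC.contDiffOn hAT) (fun q hq => hψZ (hAT hq))
    σ₀₁ σ₁₂ σ₀₂ (fun t ht => ?_) (fun t ht => ?_) (fun t ht => ?_)
  · rw [h₀₁ t ht]
    show ψ (segPoint b₀ b₁ t) = ψ (b₀ + ((t : ℝ) : ℂ) * (b₁ - b₀) + ((0 : ℝ) : ℂ) * (b₂ - b₀))
    congr 1; simp only [segPoint]; push_cast; ring
  · rw [h₁₂ t ht]
    show ψ (segPoint b₁ b₂ t) =
      ψ (b₀ + ((1 - t : ℝ) : ℂ) * (b₁ - b₀) + ((t : ℝ) : ℂ) * (b₂ - b₀))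
    congr 1; simp only [segPoint]; push_cast; ring
  · rw [h₀₂ t ht]
    show ψ (segPoint b₀ b₂ t) = ψ (b₀ + ((0 : ℝ) : ℂ) * (b₁ - b₀) + ((t : ℝ) : ℂ) * (b₂ - b₀))
    congr 1; simp only [segPoint]; push_cast; ring

end Lift

/-! ### Inside a chart neighbourhood of `exists_localChart` -/

section Chart

variable (hZ : Z.IsSmoothAffineCurve) (ω : Fin Z.n → MvPolynomial (Fin Z.n) ℂ)
  (h : ∀ i, HasAlgCoeffs (ω i)) {i₀ : Fin Z.n} {c : ℂ} {ε : ℝ} {Ω : Set (Fin Z.n → ℂ)}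
  {ψ : ℂ → (Fin Z.n → ℂ)} (hψ : AnalyticOnNhd ℂ ψ (Metric.ball c ε))
  (h1 : ∀ z ∈ Ω, z ∈ Z.points → z i₀ ∈ Metric.ball c ε ∧ ψ (z i₀) = z)
  (h2 : ∀ w ∈ Metric.ball c ε, ψ w ∈ Ω ∧ ψ w ∈ Z.points ∧ ψ w i₀ = w)

include hψ h1 h2 in
/-- **Paths in one chart neighbourhood with the same end points are equivalent.** With
`(i₀, ε, Ω, ψ)` a chart as in `exists_localChart` (centre `c`), two `C¹` paths on `Z` with
`γ_r([0,1]) ⊆ Ω` and common end points satisfy `(Z, ω, γ₀) ∼ (Z, ω, γ₁)` (their `i₀`-th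
coordinates are lifts to the disc). [cite: HuberWustholz2022, §3.3.1 (pp. 42–44)] -/
theorem span_single_sub_single_of_subset_chart (γ₀ γ₁ : CurvePath Z)
    (hγ₀ : ∀ t ∈ Icc (0 : ℝ) 1, γ₀.toFun t ∈ Ω) (hγ₁ : ∀ t ∈ Icc (0 : ℝ) 1, γ₁.toFun t ∈ Ω)
    (h0 : γ₀.toFun 0 = γ₁.toFun 0) (h1' : γ₀.toFun 1 = γ₁.toFun 1) :
    InSpan (Finsupp.single (⟨Z, hZ, ω, h, γ₀⟩ : PeriodSymbol) (1 : ℂ) -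
        Finsupp.single ⟨Z, hZ, ω, h, γ₁⟩ 1) := by
  refine span_single_sub_single_of_lift (convex_ball c ε) hψ (fun w hw => (h2 w hw).2.1) hZ ω h
    γ₀ γ₁ (fun t => γ₀.toFun t i₀) (fun t => γ₁.toFun t i₀) (γ₀.contDiffOn_apply i₀)
    (γ₁.contDiffOn_apply i₀) (fun t ht => (h1 _ (hγ₀ t ht) (γ₀.mem_points t ht)).1)
    (fun t ht => (h1 _ (hγ₁ t ht) (γ₁.mem_points t ht)).1)
    (fun t ht => ((h1 _ (hγ₀ t ht) (γ₀.mem_points t ht)).2).symm)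
    (fun t ht => ((h1 _ (hγ₁ t ht) (γ₁.mem_points t ht)).2).symm) (by rw [h0]) (by rw [h1'])

include hψ h1 h2 in
/-- **A loop inside one chart neighbourhood is a relation**: a `C¹` loop on `Z` at an algebraic
point with `γ([0,1]) ⊆ Ω` satisfies `(Z, ω, γ) ∼ 0`. [cite: HuberWustholz2022, §3.3.1 (pp. 42–44)] -/
theorem span_single_of_loop_subset_chart (γ : CurvePath Z) (hγ : ∀ t ∈ Icc (0 : ℝ) 1, γ.toFun t ∈ Ω)
    (hloop : γ.toFun 1 = γ.toFun 0) :
    InSpan (Finsupp.single (⟨Z, hZ, ω, h, γ⟩ : PeriodSymbol) (1 : ℂ)) := by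
  -- compare with the constant loop
  let κ : CurvePath Z :=
    { toFun := fun _ => γ.toFun 0
      contDiffOn := contDiffOn_const
      mem_points := fun _ _ => γ.mem_points 0 ⟨le_rfl, zero_le_one⟩
      algebraic_zero := γ.algebraic_zero
      algebraic_one := γ.algebraic_zero }
  have hκ : IsElementaryRelation (Finsupp.single (⟨Z, hZ, ω, h, κ⟩ : PeriodSymbol) 1) :=
    isElementaryRelation_single_of_const hZ ω h κ (γ.toFun 0) fun _ _ => rfl
  have hd := span_single_sub_single_of_subset_chart hZ ω h hψ h1 h2 γ κ hγ
    (fun _ _ => hγ 0 ⟨le_rfl, zero_le_one⟩) rfl hloop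
  have := span_add hd (span_of_rel hκ)
  rwa [sub_add_cancel] at this

include hψ h1 h2 in
/-- **The cell relation**: four `C¹` paths inside one chart neighbourhood forming a quadrilateral
with algebraic corners `p₀ → p₁ → p₂ → p₃` and `p₀ → p₃` satisfy
`(γ₀₁) + (γ₁₂) + (γ₂₃) − (γ₀₃) ∼ 0` (two chart triangles and four lifts).
[cite: HuberWustholz2022, §3.3.1 (pp. 42–44)] -/
theorem span_quadrilateral_of_subset_chart (γ₀₁ γ₁₂ γ₂₃ γ₀₃ : CurvePath Z)
    (s₀₁ : ∀ t ∈ Icc (0 : ℝ) 1, γ₀₁.toFun t ∈ Ω) (s₁₂ : ∀ t ∈ Icc (0 : ℝ) 1, γ₁₂.toFun t ∈ Ω)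
    (s₂₃ : ∀ t ∈ Icc (0 : ℝ) 1, γ₂₃.toFun t ∈ Ω) (s₀₃ : ∀ t ∈ Icc (0 : ℝ) 1, γ₀₃.toFun t ∈ Ω)
    (j₁ : γ₀₁.toFun 1 = γ₁₂.toFun 0) (j₂ : γ₁₂.toFun 1 = γ₂₃.toFun 0)
    (j₀ : γ₀₁.toFun 0 = γ₀₃.toFun 0) (j₃ : γ₂₃.toFun 1 = γ₀₃.toFun 1) :
    InSpan (Finsupp.single (⟨Z, hZ, ω, h, γ₀₁⟩ : PeriodSymbol) (1 : ℂ) +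
        Finsupp.single ⟨Z, hZ, ω, h, γ₁₂⟩ 1 + Finsupp.single ⟨Z, hZ, ω, h, γ₂₃⟩ 1 -
          Finsupp.single ⟨Z, hZ, ω, h, γ₀₃⟩ 1) := by
  have hI0 : (0 : ℝ) ∈ Icc (0 : ℝ) 1 := ⟨le_rfl, zero_le_one⟩
  have hI1 : (1 : ℝ) ∈ Icc (0 : ℝ) 1 := ⟨zero_le_one, le_rfl⟩
  have hT : Convex ℝ (Metric.ball c ε) := convex_ball c ε
  have hψZ : MapsTo ψ (Metric.ball c ε) Z.points := fun w hw => (h2 w hw).2.1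
  -- the corners and their parameters
  set p₀ := γ₀₁.toFun 0 with hp₀
  set p₁ := γ₁₂.toFun 0 with hp₁
  set p₂ := γ₂₃.toFun 0 with hp₂
  set p₃ := γ₀₃.toFun 1 with hp₃
  have hq₀ := h1 p₀ (s₀₁ 0 hI0) (γ₀₁.mem_points 0 hI0)
  have hq₁ := h1 p₁ (s₁₂ 0 hI0) (γ₁₂.mem_points 0 hI0)
  have hq₂ := h1 p₂ (s₂₃ 0 hI0) (γ₂₃.mem_points 0 hI0)
  have hq₃ := h1 p₃ (s₀₃ 1 hI1) (γ₀₃.mem_points 1 hI1)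
  have ha₀ : ∀ i, IsAlgebraic ℚ (ψ (p₀ i₀) i) := fun i => by rw [hq₀.2]; exact γ₀₁.algebraic_zero i
  have ha₁ : ∀ i, IsAlgebraic ℚ (ψ (p₁ i₀) i) := fun i => by rw [hq₁.2]; exact γ₁₂.algebraic_zero i
  have ha₂ : ∀ i, IsAlgebraic ℚ (ψ (p₂ i₀) i) := fun i => by rw [hq₂.2]; exact γ₂₃.algebraic_zero i
  have ha₃ : ∀ i, IsAlgebraic ℚ (ψ (p₃ i₀) i) := fun i => by rw [hq₃.2]; exact γ₀₃.algebraic_one i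
  -- the chart-straight paths
  let σ₀₁ := chartSegment hT hψ hψZ (p₀ i₀) (p₁ i₀) hq₀.1 hq₁.1 ha₀ ha₁
  let σ₁₂ := chartSegment hT hψ hψZ (p₁ i₀) (p₂ i₀) hq₁.1 hq₂.1 ha₁ ha₂
  let σ₂₃ := chartSegment hT hψ hψZ (p₂ i₀) (p₃ i₀) hq₂.1 hq₃.1 ha₂ ha₃
  let σ₀₂ := chartSegment hT hψ hψZ (p₀ i₀) (p₂ i₀) hq₀.1 hq₂.1 ha₀ ha₂
  let σ₀₃ := chartSegment hT hψ hψZ (p₀ i₀) (p₃ i₀) hq₀.1 hq₃.1 ha₀ ha₃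
  have hσΩ : ∀ {b₀ b₁ : ℂ} (hb₀ : b₀ ∈ Metric.ball c ε) (hb₁ : b₁ ∈ Metric.ball c ε),
      ∀ t ∈ Icc (0 : ℝ) 1, ψ (segPoint b₀ b₁ t) ∈ Ω := fun hb₀ hb₁ t ht =>
    (h2 _ (segPoint_mem hT hb₀ hb₁ ht)).1
  -- two chart triangles
  have hr₁ := rel_chartTriangle hT hψ hψZ hZ ω h hq₀.1 hq₁.1 hq₂.1 σ₀₁ σ₁₂ σ₀₂
    (fun _ _ => rfl) (fun _ _ => rfl) (fun _ _ => rfl)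
  have hr₂ := rel_chartTriangle hT hψ hψZ hZ ω h hq₀.1 hq₂.1 hq₃.1 σ₀₂ σ₂₃ σ₀₃
    (fun _ _ => rfl) (fun _ _ => rfl) (fun _ _ => rfl)
  -- four lifts
  have e₀₁ := span_single_sub_single_of_subset_chart hZ ω h hψ h1 h2 γ₀₁ σ₀₁ s₀₁
    (hσΩ hq₀.1 hq₁.1) (by show p₀ = ψ (segPoint (p₀ i₀) (p₁ i₀) 0); rw [segPoint_zero, hq₀.2])
    (by show γ₀₁.toFun 1 = ψ (segPoint (p₀ i₀) (p₁ i₀) 1); rw [segPoint_one, hq₁.2, j₁])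
  have e₁₂ := span_single_sub_single_of_subset_chart hZ ω h hψ h1 h2 γ₁₂ σ₁₂ s₁₂
    (hσΩ hq₁.1 hq₂.1) (by show p₁ = ψ (segPoint (p₁ i₀) (p₂ i₀) 0); rw [segPoint_zero, hq₁.2])
    (by show γ₁₂.toFun 1 = ψ (segPoint (p₁ i₀) (p₂ i₀) 1); rw [segPoint_one, hq₂.2, j₂])
  have e₂₃ := span_single_sub_single_of_subset_chart hZ ω h hψ h1 h2 γ₂₃ σ₂₃ s₂₃
    (hσΩ hq₂.1 hq₃.1) (by show p₂ = ψ (segPoint (p₂ i₀) (p₃ i₀) 0); rw [segPoint_zero, hq₂.2])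
    (by show γ₂₃.toFun 1 = ψ (segPoint (p₂ i₀) (p₃ i₀) 1); rw [segPoint_one, hq₃.2, j₃])
  have e₀₃ := span_single_sub_single_of_subset_chart hZ ω h hψ h1 h2 γ₀₃ σ₀₃ s₀₃
    (hσΩ hq₀.1 hq₃.1)
    (by show γ₀₃.toFun 0 = ψ (segPoint (p₀ i₀) (p₃ i₀) 0); rw [segPoint_zero, hq₀.2, j₀])
    (by show p₃ = ψ (segPoint (p₀ i₀) (p₃ i₀) 1); rw [segPoint_one, hq₃.2])
  obtain ⟨k, ρ, a, hρ, ha, he⟩ := span_add (span_sub (span_add (span_add e₀₁ e₁₂) e₂₃) e₀₃)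
    (span_add (span_of_rel hr₁) (span_of_rel hr₂))
  exact ⟨k, ρ, a, hρ, ha, by rw [← he]; abel⟩

include hψ h1 h2 in
/-- **The cell relation in grid orientation**: for four `C¹` paths inside one chart
neighbourhood, `γb : p₀ → p₁` (bottom), `γr : p₁ → p₂` (right), `γt : p₃ → p₂` (top, left to
right) and `γl : p₀ → p₃` (left, upwards), with algebraic corners,
`(γb) + (γr) − (γt) − (γl) ∼ 0`. [cite: HuberWustholz2022, §3.3.1 (pp. 42–44)] -/
theorem span_cell_of_subset_chart (γb γr γt γl : CurvePath Z)
    (sb : ∀ t ∈ Icc (0 : ℝ) 1, γb.toFun t ∈ Ω) (sr : ∀ t ∈ Icc (0 : ℝ) 1, γr.toFun t ∈ Ω)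
    (st : ∀ t ∈ Icc (0 : ℝ) 1, γt.toFun t ∈ Ω) (sl : ∀ t ∈ Icc (0 : ℝ) 1, γl.toFun t ∈ Ω)
    (j₁ : γb.toFun 1 = γr.toFun 0) (j₂ : γr.toFun 1 = γt.toFun 1)
    (j₀ : γb.toFun 0 = γl.toFun 0) (j₃ : γt.toFun 0 = γl.toFun 1) :
    InSpan (Finsupp.single (⟨Z, hZ, ω, h, γb⟩ : PeriodSymbol) (1 : ℂ) +
        Finsupp.single ⟨Z, hZ, ω, h, γr⟩ 1 - Finsupp.single ⟨Z, hZ, ω, h, γt⟩ 1 -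
          Finsupp.single ⟨Z, hZ, ω, h, γl⟩ 1) := by
  have hq := span_quadrilateral_of_subset_chart hZ ω h hψ h1 h2 γb γr γt.reverse γl sb sr
    (fun t ht => st (1 - t) (one_sub_mem_Icc ht)) sl j₁
    (by show γr.toFun 1 = γt.toFun (1 - 0); rw [sub_zero, j₂]) j₀
    (by show γt.toFun (1 - 1) = γl.toFun 1; rw [sub_self, j₃])
  have hrev := span_single_add_single_reverse hZ ω h γt
  obtain ⟨k, ρ, a, hρ, ha, he⟩ := span_sub hq hrev
  exact ⟨k, ρ, a, hρ, ha, by rw [← he]; abel⟩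

end Chart

end CurvePeriods

end Literature.NumberTheory.Transcendental

end
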